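import Mathlib
import HarnessLib
import Literature.Analysis.FluidPDE.MeridianReduction
import Literature.Analysis.FluidPDE.SwirlCutoff
import Literature.Barriers.NavierStokesRegularity.NavierStokesInequalitySwirlLaplacian

/-!
# Route `AxisTwistDoor`, crux `AveragedConeLiouville` (stmt-NavierStokesRegularity-26889), line `lrt_shell`, stub (5b)
# `stub_axisHarnackChain` — brick H1: the AXISYMMETRIC LIFT of the axis circulation and its comparison function
# (Lei–Ren–Tian arXiv:2501.08976, §4 p. 11: "It is useful to think of Γ as an axi-symmetric function in three space
# dimensions … Applying Lemma 2.5 to V in 𝒟₁ viewed as a 3D axisymmetric domain")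

For a function `Γ(r,z,s)` that is `C²` in `(r,z,s)` on `s < 0` (the PDE datum (H1) of the line), its LIFT
`Γ̂_t(x) = Γ(|x_h|, x₃, t)` to `ℝ³` is, off the axis, a `C²` function with
* `Δ Γ̂_t (x) = ∂ᵣ²Γ + r⁻¹∂ᵣΓ + ∂_z²Γ` (cylindrical Laplacian of an axisymmetric scalar; tree:
  `laplacian_comp_meridian`, applied to a cut-off copy vanishing near the axis, `Δ` being local),
* `∇ Γ̂_t (x) = ∂ᵣΓ ρ̂(x) + ∂_zΓ ẑ` (`gradient_comp_meridian`),
all partial derivatives written as the iterated one-variable `deriv`s of the line's statements.  Consequently the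
COMPARISON FUNCTION `V(t,x) = M − Γ̂_t(x)` satisfies, at every off-axis point where eq. Gamma-34 in the form
`∂ₛΓ − ∂_z²Γ − ∂ᵣ²Γ + ((1 − C_d)/r) ∂ᵣΓ ≤ 0` holds,
`∂ₜV − ΔV + ⟪((2 − C_d)/r) ρ̂, ∇V⟫ ≥ 0` — a classical supersolution with the RADIAL drift `((2−C_d)/r) ρ̂`
(bounded and divergence-free off the axis: cas-k2's `…RadialDrift`), the input of the positivity-propagation fact.

Seat ns-atd-p1 (LEAD). WHAT THIS IS NOT: not a statement about Navier–Stokes regularity; multivariable calculus for a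
STAGED door route. Lands `--supports` the crux item as a helper.
-/

noncomputable section

-- the summit and its single sub-problem share the name (CONVENTIONS §1), as in every Theorems file
set_option linter.dupNamespace false

namespace Summit.NavierStokesRegularity.NavierStokesRegularity.Theorems.AxisTwistDoorAveragedConeLiouvilleAxisLift

open scoped InnerProductSpace Laplacian ContDiff Topology
open Set Function Filter
open Literature.Analysis.FluidPDE
open Literature.Barriers.NavierStokesRegularity

variable {Γ : ℝ → ℝ → ℝ → ℝ}

/-- The planar slice `q = (r,z) ↦ Γ(r,z,t)` at time `t`. -/
def slice (Γ : ℝ → ℝ → ℝ → ℝ) (t : ℝ) : ℝ × ℝ → ℝ := fun q => Γ q.1 q.2 t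

/-- The axisymmetric lift `x ↦ Γ(|x_h|, x₃, t)` at time `t`. -/
def lift (Γ : ℝ → ℝ → ℝ → ℝ) (t : ℝ) : EuclideanSpace ℝ (Fin 3) → ℝ := fun x => Γ (cylRadius x) (x 2) t

/-- The lift is the slice composed with the meridian projection (definitional). -/
theorem lift_eq_slice_comp_meridian (Γ : ℝ → ℝ → ℝ → ℝ) (t : ℝ) :
    lift Γ t = fun x => slice Γ t (meridian x) := rfl

/-! ### The planar slice: smoothness and its partial derivatives as iterated `deriv`s -/

/-- The slice at a negative time of a function `C²` in `(r,z,s)` on `s < 0` is `C²` on the plane. -/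
theorem contDiff_slice (hΓ : ContDiffOn ℝ 2 (fun q : ℝ × ℝ × ℝ => Γ q.1 q.2.1 q.2.2) {q | q.2.2 < 0})
    {t : ℝ} (ht : t < 0) : ContDiff ℝ 2 (slice Γ t) := by
  have hι : ContDiff ℝ 2 fun q : ℝ × ℝ => ((q.1, (q.2, t)) : ℝ × ℝ × ℝ) :=
    contDiff_fst.prodMk (contDiff_snd.prodMk contDiff_const)
  have hmaps : MapsTo (fun q : ℝ × ℝ => ((q.1, (q.2, t)) : ℝ × ℝ × ℝ)) univ {q | q.2.2 < 0} :=
    fun q _ => ht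
  have h := hΓ.comp hι.contDiffOn hmaps
  rw [contDiffOn_univ] at h
  exact h

/-- `∂ᵣ` of the slice is the `r`-derivative of the one-variable section. -/
theorem derivR_slice {t : ℝ} (hd : Differentiable ℝ (slice Γ t)) (r z : ℝ) :
    derivR (slice Γ t) (r, z) = deriv (fun r' => Γ r' z t) r := by
  have h1 : HasDerivAt (fun r' : ℝ => ((r', z) : ℝ × ℝ)) ((1 : ℝ), (0 : ℝ)) r := by
    have := (hasDerivAt_id r).prodMk (hasDerivAt_const r z)
    simpa using this
  have h2 := (hd (r, z)).hasFDerivAt.comp_hasDerivAt r h1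
  rw [derivR, ← h2.deriv]
  rfl

/-- `∂_z` of the slice is the `z`-derivative of the one-variable section. -/
theorem derivZ_slice {t : ℝ} (hd : Differentiable ℝ (slice Γ t)) (r z : ℝ) :
    derivZ (slice Γ t) (r, z) = deriv (fun z' => Γ r z' t) z := by
  have h1 : HasDerivAt (fun z' : ℝ => ((r, z') : ℝ × ℝ)) ((0 : ℝ), (1 : ℝ)) z := by
    have := (hasDerivAt_const z r).prodMk (hasDerivAt_id z)
    simpa using this
  have h2 := (hd (r, z)).hasFDerivAt.comp_hasDerivAt z h1
  rw [derivZ, ← h2.deriv]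
  rfl

/-- `∂ᵣ∂ᵣ` of a `C²` slice as an iterated one-variable derivative. -/
theorem derivR_derivR_slice {t : ℝ} (h2 : ContDiff ℝ 2 (slice Γ t)) (r z : ℝ) :
    derivR (derivR (slice Γ t)) (r, z) = deriv (fun r' => deriv (fun r'' => Γ r'' z t) r') r := by
  have hd : Differentiable ℝ (slice Γ t) := h2.differentiable two_ne_zero
  have hd' : Differentiable ℝ (derivR (slice Γ t)) := by
    have : derivR (slice Γ t) = fun q => fderiv ℝ (slice Γ t) q ((1 : ℝ), (0 : ℝ)) := rfl
    rw [this]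
    exact ((h2.fderiv_right (m := 1) le_rfl).clm_apply contDiff_const).differentiable one_ne_zero
  have h1 : HasDerivAt (fun r' : ℝ => ((r', z) : ℝ × ℝ)) ((1 : ℝ), (0 : ℝ)) r := by
    have := (hasDerivAt_id r).prodMk (hasDerivAt_const r z)
    simpa using this
  have h3 := (hd' (r, z)).hasFDerivAt.comp_hasDerivAt r h1
  have h4 : (derivR (slice Γ t) ∘ fun r' : ℝ => ((r', z) : ℝ × ℝ)) = fun r' => deriv (fun r'' => Γ r'' z t) r' := by
    funext r'; exact derivR_slice hd r' z
  rw [derivR, ← h3.deriv, h4]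

/-- `∂_z∂_z` of a `C²` slice as an iterated one-variable derivative. -/
theorem derivZ_derivZ_slice {t : ℝ} (h2 : ContDiff ℝ 2 (slice Γ t)) (r z : ℝ) :
    derivZ (derivZ (slice Γ t)) (r, z) = deriv (fun z' => deriv (fun z'' => Γ r z'' t) z') z := by
  have hd : Differentiable ℝ (slice Γ t) := h2.differentiable two_ne_zero
  have hd' : Differentiable ℝ (derivZ (slice Γ t)) := by
    have : derivZ (slice Γ t) = fun q => fderiv ℝ (slice Γ t) q ((0 : ℝ), (1 : ℝ)) := rfl
    rw [this]
    exact ((h2.fderiv_right (m := 1) le_rfl).clm_apply contDiff_const).differentiable one_ne_zero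
  have h1 : HasDerivAt (fun z' : ℝ => ((r, z') : ℝ × ℝ)) ((0 : ℝ), (1 : ℝ)) z := by
    have := (hasDerivAt_const z r).prodMk (hasDerivAt_id z)
    simpa using this
  have h3 := (hd' (r, z)).hasFDerivAt.comp_hasDerivAt z h1
  have h4 : (derivZ (slice Γ t) ∘ fun z' : ℝ => ((r, z') : ℝ × ℝ)) = fun z' => deriv (fun z'' => Γ r z'' t) z' := by
    funext z'; exact derivZ_slice hd r z'
  rw [derivZ, ← h3.deriv, h4]

/-! ### A cut-off copy of the slice vanishing near the axis -/

/-- The radial cut-off `χ_{r₀}(q) = smoothTransition ((q.1 − r₀/2)/(r₀/2))`: smooth, `= 0` for `q.1 ≤ r₀/2`,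
`= 1` for `q.1 ≥ r₀`. -/
def cutoff (r₀ : ℝ) (q : ℝ × ℝ) : ℝ := Real.smoothTransition ((q.1 - r₀ / 2) / (r₀ / 2))

/-- The cut-off is smooth. -/
theorem contDiff_cutoff (r₀ : ℝ) {n : ℕ∞} : ContDiff ℝ n (cutoff r₀) :=
  Real.smoothTransition.contDiff.comp ((contDiff_fst.sub contDiff_const).div_const _)

/-- The cut-off vanishes for `q.1 < r₀/2` (`r₀ > 0`). -/
theorem cutoff_eq_zero {r₀ : ℝ} (hr₀ : 0 < r₀) {q : ℝ × ℝ} (hq : q.1 < r₀ / 2) : cutoff r₀ q = 0 := by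
  unfold cutoff
  apply Real.smoothTransition.zero_of_nonpos
  have : q.1 - r₀ / 2 ≤ 0 := by linarith
  exact div_nonpos_of_nonpos_of_nonneg this (by linarith)

/-- The cut-off equals `1` for `q.1 ≥ r₀` (`r₀ > 0`). -/
theorem cutoff_eq_one {r₀ : ℝ} (hr₀ : 0 < r₀) {q : ℝ × ℝ} (hq : r₀ ≤ q.1) : cutoff r₀ q = 1 := by
  unfold cutoff
  apply Real.smoothTransition.one_of_one_le
  rw [le_div_iff₀ (by linarith)]
  linarith

/-- The cut-off slice agrees with the slice on the half-plane `q.1 > r₀`, a neighbourhood of any of its points. -/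
theorem cutoff_mul_slice_eventuallyEq {r₀ : ℝ} (hr₀ : 0 < r₀) (t : ℝ) {q : ℝ × ℝ} (hq : r₀ < q.1) :
    (fun q' => cutoff r₀ q' * slice Γ t q') =ᶠ[𝓝 q] slice Γ t := by
  filter_upwards [(isOpen_lt continuous_const continuous_fst).mem_nhds hq] with q' hq'
  rw [cutoff_eq_one hr₀ (le_of_lt hq'), one_mul]

/-! ### The Laplacian and the gradient of the lift off the axis -/

/-- **Cylindrical Laplacian of the lift**: off the axis and at a negative time,
`Δ Γ̂_t (x) = ∂ᵣ²Γ + r⁻¹ ∂ᵣΓ + ∂_z²Γ` at `(r,z) = (|x_h|, x₃)`. -/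
theorem laplacian_lift (hΓ : ContDiffOn ℝ 2 (fun q : ℝ × ℝ × ℝ => Γ q.1 q.2.1 q.2.2) {q | q.2.2 < 0})
    {t : ℝ} (ht : t < 0) {x : EuclideanSpace ℝ (Fin 3)} (hx : cylRadius x ≠ 0) :
    (Δ (lift Γ t)) x =
      deriv (fun r' => deriv (fun r'' => Γ r'' (x 2) t) r') (cylRadius x)
        + (cylRadius x)⁻¹ * deriv (fun r' => Γ r' (x 2) t) (cylRadius x)
        + deriv (fun z' => deriv (fun z'' => Γ (cylRadius x) z'' t) z') (x 2) := by
  have h2 : ContDiff ℝ 2 (slice Γ t) := contDiff_slice hΓ ht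
  have hr : 0 < cylRadius x := lt_of_le_of_ne (cylRadius_nonneg x) (Ne.symm hx)
  -- the cut-off copy, globally `C²` as a function on `ℝ³`
  set r₀ : ℝ := cylRadius x / 2 with hr₀
  have hr₀pos : 0 < r₀ := by positivity
  set γ : ℝ × ℝ → ℝ := fun q => cutoff r₀ q * slice Γ t q with hγ
  have hγ2 : ContDiff ℝ 2 γ := (contDiff_cutoff r₀).mul h2
  have hγ0 : ∀ q : ℝ × ℝ, q.1 < r₀ / 2 → γ q = 0 := fun q hq => by
    simp only [hγ, cutoff_eq_zero hr₀pos hq, zero_mul]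
  have hlift2 : ContDiff ℝ 2 fun w : EuclideanSpace ℝ (Fin 3) => γ (meridian w) :=
    contDiff_comp_meridian_of_eq_zero hγ2 (by positivity) hγ0
  -- the two lifts agree near `x`
  have hxr : r₀ < cylRadius x := by rw [hr₀]; linarith
  have hnear : (lift Γ t) =ᶠ[𝓝 x] fun w => γ (meridian w) := by
    have ho : IsOpen {w : EuclideanSpace ℝ (Fin 3) | r₀ < cylRadius w} :=
      isOpen_lt continuous_const continuous_cylRadius
    filter_upwards [ho.mem_nhds hxr] with w hw
    have hw' : r₀ ≤ (meridian w).1 := le_of_lt (by simpa [meridian_apply] using hw)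
    rw [hγ]
    show lift Γ t w = cutoff r₀ (meridian w) * slice Γ t (meridian w)
    rw [cutoff_eq_one hr₀pos hw', one_mul]
    rfl
  rw [(InnerProductSpace.laplacian_congr_nhds hnear).self_of_nhds, laplacian_comp_meridian hlift2 hx]
  -- the planar derivatives of `γ` at `q = meridian x` are those of the slice
  have hq : r₀ < (meridian x).1 := by simpa [meridian_apply] using hxr
  have hev : γ =ᶠ[𝓝 (meridian x)] slice Γ t := cutoff_mul_slice_eventuallyEq hr₀pos t hq
  have hR : derivR γ =ᶠ[𝓝 (meridian x)] derivR (slice Γ t) := by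
    filter_upwards [hev.eventually_nhds] with q hq'
    have hq'' : γ =ᶠ[𝓝 q] slice Γ t := hq'
    rw [derivR, derivR, hq''.fderiv_eq]
  have hZ : derivZ γ =ᶠ[𝓝 (meridian x)] derivZ (slice Γ t) := by
    filter_upwards [hev.eventually_nhds] with q hq'
    have hq'' : γ =ᶠ[𝓝 q] slice Γ t := hq'
    rw [derivZ, derivZ, hq''.fderiv_eq]
  have e1 : derivR γ (meridian x) = derivR (slice Γ t) (meridian x) := hR.self_of_nhds
  have e2 : derivR (derivR γ) (meridian x) = derivR (derivR (slice Γ t)) (meridian x) := by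
    rw [derivR, derivR, hR.fderiv_eq]
  have e3 : derivZ (derivZ γ) (meridian x) = derivZ (derivZ (slice Γ t)) (meridian x) := by
    rw [derivZ, derivZ, hZ.fderiv_eq]
  rw [e1, e2, e3, meridian_apply, derivR_derivR_slice h2, derivR_slice (h2.differentiable two_ne_zero),
    derivZ_derivZ_slice h2]

/-- **Gradient of the lift** off the axis: `∇ Γ̂_t (x) = ∂ᵣΓ ρ̂(x) + ∂_zΓ ẑ`. -/
theorem gradient_lift (hΓ : ContDiffOn ℝ 2 (fun q : ℝ × ℝ × ℝ => Γ q.1 q.2.1 q.2.2) {q | q.2.2 < 0})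
    {t : ℝ} (ht : t < 0) {x : EuclideanSpace ℝ (Fin 3)} (hx : cylRadius x ≠ 0) :
    gradient (lift Γ t) x =
      deriv (fun r' => Γ r' (x 2) t) (cylRadius x) • eR x + deriv (fun z' => Γ (cylRadius x) z' t) (x 2) • eZ := by
  have hd : Differentiable ℝ (slice Γ t) := (contDiff_slice hΓ ht).differentiable two_ne_zero
  rw [lift_eq_slice_comp_meridian, gradient_comp_meridian hx (hd (meridian x))]
  show derivR (slice Γ t) (cylRadius x, x 2) • eR x + derivZ (slice Γ t) (cylRadius x, x 2) • eZ = _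
  rw [derivR_slice hd, derivZ_slice hd]

/-- The lift is `C²` near every off-axis point (at a negative time). -/
theorem contDiffAt_lift (hΓ : ContDiffOn ℝ 2 (fun q : ℝ × ℝ × ℝ => Γ q.1 q.2.1 q.2.2) {q | q.2.2 < 0})
    {t : ℝ} (ht : t < 0) {x : EuclideanSpace ℝ (Fin 3)} (hx : cylRadius x ≠ 0) :
    ContDiffAt ℝ 2 (lift Γ t) x := by
  rw [lift_eq_slice_comp_meridian]
  exact (contDiff_slice hΓ ht).contDiffAt.comp x (contDiffAt_meridian hx)

/-! ### The comparison function `V = M − Γ̂` is a supersolution with radial drift -/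

/-- **Supersolution property of the comparison function.** If at the off-axis point `x` and the negative time `t`
eq. Gamma-34 holds in the form `∂ₛΓ − ∂_z²Γ − ∂ᵣ²Γ + ((1 − C_d)/r) ∂ᵣΓ ≤ 0` (`r = |x_h|`, `z = x₃`), then
`V(t,x) = M − Γ(|x_h|, x₃, t)` satisfies `∂ₜV − ΔV + ⟪((2 − C_d)/r) ρ̂(x), ∇V⟫ ≥ 0` there. -/
theorem supersolution_lift (hΓ : ContDiffOn ℝ 2 (fun q : ℝ × ℝ × ℝ => Γ q.1 q.2.1 q.2.2) {q | q.2.2 < 0})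
    {t : ℝ} (ht : t < 0) {x : EuclideanSpace ℝ (Fin 3)} (hx : cylRadius x ≠ 0) (Cd M : ℝ)
    (h34 : deriv (fun s' => Γ (cylRadius x) (x 2) s') t
      - deriv (fun z' => deriv (fun z'' => Γ (cylRadius x) z'' t) z') (x 2)
      - deriv (fun r' => deriv (fun r'' => Γ r'' (x 2) t) r') (cylRadius x)
      + ((1 - Cd) / cylRadius x) * deriv (fun r' => Γ r' (x 2) t) (cylRadius x) ≤ 0) :
    0 ≤ deriv (fun τ => M - lift Γ τ x) t - (Δ (fun y => M - lift Γ t y)) x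
      + ⟪((2 - Cd) / cylRadius x) • eR x, gradient (fun y => M - lift Γ t y) x⟫_ℝ := by
  -- time derivative
  have hdt : deriv (fun τ => M - lift Γ τ x) t = -deriv (fun s' => Γ (cylRadius x) (x 2) s') t := by
    simp only [lift, deriv_const_sub]
  -- Laplacian
  have hΔ : (Δ (fun y => M - lift Γ t y)) x = -(Δ (lift Γ t)) x := by
    have e : (fun y => M - lift Γ t y) = (fun _ => M) - lift Γ t := rfl
    rw [e, ContDiffAt.laplacian_sub contDiffAt_const (contDiffAt_lift hΓ ht hx)]
    simp [InnerProductSpace.laplacian_const]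
  -- gradient
  have hgrad : gradient (fun y => M - lift Γ t y) x = -gradient (lift Γ t) x := by
    rw [gradient, gradient, fderiv_const_sub, map_neg]
  rw [hdt, hΔ, hgrad, laplacian_lift hΓ ht hx, gradient_lift hΓ ht hx, inner_neg_right, real_inner_smul_left,
    inner_add_right, real_inner_smul_right, real_inner_smul_right, inner_eR_self hx, inner_eR_eZ]
  have hr : 0 < cylRadius x := lt_of_le_of_ne (cylRadius_nonneg x) (Ne.symm hx)
  set A : ℝ := (cylRadius x)⁻¹ * deriv (fun r' => Γ r' (x 2) t) (cylRadius x) with hA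
  have e1 : (1 - Cd) / cylRadius x * deriv (fun r' => Γ r' (x 2) t) (cylRadius x) = (1 - Cd) * A := by
    rw [hA]; ring
  have e2 : (2 - Cd) / cylRadius x *
      (deriv (fun r' => Γ r' (x 2) t) (cylRadius x) * 1 + deriv (fun z' => Γ (cylRadius x) z' t) (x 2) * 0)
      = (2 - Cd) * A := by
    rw [hA]; ring
  rw [e2]
  rw [e1] at h34
  nlinarith [h34]

end Summit.NavierStokesRegularity.NavierStokesRegularity.Theorems.AxisTwistDoorAveragedConeLiouvilleAxisLift

end
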